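import Summits.AtomisticToContinuum.FouriersLaw.Theses.OddSectorIrreversibility
import Literature.MathematicalPhysics.KineticTheory.OddSectorLocalityHypothesis
import Literature.MathematicalPhysics.KineticTheory.LangevinChainKernel
import Literature.MathematicalPhysics.KineticTheory.LangevinChainGibbs
import Summits.AtomisticToContinuum.FouriersLaw.Theorems.OddSectorIrreversibilityConeScaleCorrectorStubHorizonCorrectorMemLp

/-!
# Line `one-crossing-echo-contraction` — checked skeleton for crux `ConeScaleCorrector` (E1)

Crux: `Summit.AtomisticToContinuum.FouriersLaw.Theses.OddSectorIrreversibility.ConeScaleCorrector`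
(stmt-AtomisticToContinuum-14069, route `route-AtomisticToContinuum-OddSectorIrreversibility`, rank 2):
for `ω₂ lam β γ > 0`, `T > 0` there is `C(T)` with, for every `N` and every `μ_T`-a.e. limit `u` of
the finite-horizon Kubo correctors `u_S = ∫₀^S P_t J_tot dt` of the equilibrium OPEN chain,
`u ∈ L²(μ_T)` and `∫ u² dμ_T ≤ C · N² · Z` (`μ_T = e^{-H_N/T} dq dp` unnormalised, `Z` its mass).

Idea card: `Cruxes/ConeScaleCorrector/Ideas/one-crossing-echo-contraction.md` (crux-ideate r1 k1;
triage r1: pass ×3). Notation: `u_S(x) = ∫₀^S (P_t J_tot)(x) dt` (`horizonCorrector`, EXPLICIT — no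
limit), `r_N(S) = ‖u_S‖_{L²(μ_T)}`, `P_L u_S = u_{S+L} - u_L` (Chapman–Kolmogorov; used only as a
reading, never in the glue), `Q_τ = P_τ^* P_τ = Θ P_τ Θ P_τ` the Loschmidt-echo operator
(`‖P_τ f‖² = ⟨Q_τ f, f⟩`, generalised detailed balance `P_τ^* = Θ P_τ Θ`, KDN (reln2)).

## THE CUT  E1 ⟸ (B) ∧ (EC′) ∧ (M)

* (B)  `stub_finiteHorizonBudget` — Einstein–Helfand budget of the OPEN chain up to one causal
       crossing: `∫ u_S² dμ_T ≤ C(a,T) · N² · Z` for `0 ≤ S ≤ a·N`, every `a > 0` (conditional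
       Jensen `‖u_S‖² ≤ Var_π(∫₀^S J)`; = the promote seat's C1 `ConeTransportBudget` restricted to
       the cone scale — C1 ⟹ (B) with `C(a) = (C ⊔ 0)(1+a)`, §4). N-uniform.
* (EC′) `stub_oneCrossingContraction` — THE LOAD-BEARING STUB: `∃ a > 0, θ ∈ [0,1), b ≥ 0` with
       `‖u_{S+aN} - u_{aN}‖ ≤ θ ‖u_S‖ + b · N · √Z` for every horizon `S ≥ 0` and every `N`:
       one crossing time forgets a fixed fraction of EVERY forecast, up to an `O(N)` slack (the
       slow / hydrodynamic sector, an ABSOLUTE E1-type bound — triage r1-3 (F4)). N-uniform; the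
       replica reading `‖u_S‖² - ‖P_{aN}u_S‖² = ½ E|u_S(X_{aN}) - u_S(X'_{aN})|²` makes it a
       desynchronisation statement with the numerical observable `θ_N²(τ) = ‖P_τ u_S‖²/‖u_S‖²`.
* (M)  `stub_horizonCorrectorMemLp` — fixed-`N` regularity: `u_S ∈ L²(μ_T)` for `S ≥ 0` (joint
       measurability of the constructed kernels in `(t, x)`; `‖u_S‖ ≤ S ‖J_tot‖` by Gibbs
       invariance + Jensen). No N-uniform content; it makes the Bochner/`√·` forms of (B), (EC′)
       honest and feeds Minkowski + Fatou in the glue.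

GLUE (`corrector_bound` ⟶ `ConeScaleCorrector_of`; real proof, standard axioms modulo the three stubs): Minkowski `r(S+aN) ≤ r(aN) +
‖u_{S+aN} - u_{aN}‖ ≤ A + θ r(S) + B` (`A = √C·N·√Z` from (B), `B = bN√Z`), the crossing
induction `crossing_induction` (`sup_S r(S) ≤ (A+B)/(1-θ)`, by induction on `⌊S/(aN)⌋`; `aN = 0`
handled directly), then Fatou along the crux's a.e.-limit hypothesis through the sequence `S = n`
(`MeasureTheory.Lp.eLpNorm_le_of_ae_tendsto`, `aestronglyMeasurable_of_tendsto_ae`):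
`u ∈ L²` and `∫u² ≤ ((√C + b)/(1-θ))² · N² · Z`. The a.e.-limit hypothesis is USED (Disproof §2a
`coneScaleCorrector_false_without_correctorHyp`), and only through Fatou — no `L²`-limit input.

## Disproof.lean (cdisprove cycle 1) honoured
§1 `N ≤ 1`: `J_tot ≡ 0`, all stubs trivially true there. §2a: the corrector predicate is consumed by
Fatou (above). §2b `coneScaleCorrector_false_without_anharmonicity_of`: (B) and (EC′) both FAIL at
`lam = β = 0` (ballistic budget `∫u_{aN}² ≍ N³`; band-edge phonons give `θ_N → 1`: exact Gaussian
arm of the card, `θ²(N; 2N) = .015 → .178` rising for `N = 3 … 12`), so anharmonicity is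
load-bearing in each N-uniform stub; (M) is true at `lam = β = 0` and carries no N-uniformity.
§3/§4: nothing is claimed at scale `N¹` (`coneScaleCorrectorLinear_false_of_coneFloor`); (B) sits at
`N²`, (EC′) carries the `O(N)`-in-norm slack. §5 `echo_identity`: (EC′) is its semigroup-level,
quantitative form. Neighbours: not the FalseOfLocality shape (no `∫‖P_t·‖dt`, one semigroup step at
`t = aN ≥ cN/v`: `oddCorrectorDecay_false_of_oddSectorLocalityHypothesis` does not bite);
`-- Targets: none yet`. No landed `Theorems/ConeScaleCorrector/Negative/` lemma exists to import.

## Contents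
* §0 vocabulary (`horizonCorrector`, `Zmass`; `gibbsWeight`/`currentForecast` are the Literature
  objects of `OddSectorLocalityHypothesis.lean`), all definitionally the crux's own expressions;
* §1 the three registered stubs `stub_finiteHorizonBudget` (B), `stub_oneCrossingContraction` (EC′),
  `stub_horizonCorrectorMemLp` (M) — stated over existing (Literature) declarations, the only `sorry`s;
* §2 real-analysis and `L²` glue lemmas (proved): `crossing_induction`, Minkowski in `√∫`-form, the
  Fatou step, `horizonCorrector_norm_le`, `corrector_bound` (= (B)∧(EC′)∧(M) at one parameter point ⟹
  the crux's conclusion for every a.e. limit `u`);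
* §3 `ConeScaleCorrector_of : ConeScaleCorrector` (concludes the route decl BY NAME; invokes the three
  stubs and nothing else unproved);
* §4 variants recorded for the lead (documentation only): the pure contraction (EC) (`b = 0`), the
  all-horizon diffusive envelope C1 ⟹ (B), the `S = ∞` endpoint.
-/

noncomputable section

namespace Summit.AtomisticToContinuum.FouriersLaw.Cruxes.ConeScaleCorrector.OneCrossingEchoContraction

open MeasureTheory Filter Set Topology
open scoped ENNReal NNReal BigOperators
open Literature.MathematicalPhysics.KineticTheory.HeatConduction
open Literature.MathematicalPhysics.KineticTheory.OddSectorLocality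
open Summit.AtomisticToContinuum.FouriersLaw.Theses.OddSectorIrreversibility (ConeScaleCorrector)

/-! ## §0 Vocabulary (definitionally the crux's expressions) -/

section Objects

variable (ω₂ lam β γ T : ℝ) (N : ℕ)

/-- The mass `Z = ∫ e^{-H_N/T} dq dp` of the Gibbs weight (the crux's right-hand normalisation). -/
def Zmass : ℝ :=
  ∫ x : PhaseSpace N, Real.exp (-((pinnedChain ω₂ lam β γ).hamiltonian N x) / T)

/-- The finite-horizon Kubo corrector (EXPLICIT forecast, no limit)
`u_S(x) = ∫₀^S (P_t J_tot)(x) dt = E[∫₀^S J_tot(X_t) dt | X_0 = x]` of the equilibrium OPEN chain —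
verbatim the crux's integrand `∫ t in Ioc 0 S, ∫ y, J y ∂(P.transitionKernel N T T t.toNNReal x)`. -/
def horizonCorrector (S : ℝ) (x : PhaseSpace N) : ℝ :=
  ∫ t in Set.Ioc (0 : ℝ) S, currentForecast ω₂ lam β γ T N t x

end Objects

/-! ## §1 The registered stubs

Stated over EXISTING declarations only (Literature `OddSectorLocality.currentForecast` = `P_t J_tot`,
`OddSectorLocality.gibbsWeight` = `μ_T`, the crux's own `Z`-integral), fully qualified, so that a prover's
`Theorems/` file can restate each `stub_*` verbatim without importing this workfile. In the prose,
`u_S(x) := ∫ t in Ioc 0 S, currentForecast ω₂ lam β γ T N t x` (`= horizonCorrector`, §0) and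
`Z := ∫ x, exp(-H_N(x)/T)` (`= Zmass`, §0). -/

/-- **(B) `stub_finiteHorizonBudget` — finite-horizon budget up to one causal crossing** (N-uniform; size L).
For every cone aperture `a > 0` there is `C = C(a, T)` with `∫ u_S² dμ_T ≤ C · N² · Z` for all `N`
and all horizons `0 ≤ S ≤ a·N`. Mechanism: conditional Jensen `‖u_S‖²_π ≤ Var_π(∫₀^S J_tot) =
2∫₀^S (S-r) C_N(r) dr` and N-uniform integrability of the total-current autocorrelation up to the
crossing time (`∫₀^{aN} |C_N| ≲ N`, diffusive Einstein–Helfand growth); it is the OPEN twin of the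
route's E2 `SubBallisticWindow` and the cone-scale restriction of the promote seat's C1
`ConeTransportBudget` (C1 ⟹ (B), §4). Fails at `lam = β = 0` (ballistic: `∫u_{aN}² ≍ N³·Z`), as it
must (Disproof §2b). Trivial part: `S ≤ √N` needs no dynamics (`‖u_S‖ ≤ S‖J_tot‖`, `‖J_tot‖² ≍ N·Z`);
the content is `√N ≪ S ≤ aN` (decorrelation, not norm loss). -/
theorem stub_finiteHorizonBudget :
    ∀ ω₂ lam β γ : ℝ, 0 < ω₂ → 0 < lam → 0 < β → 0 < γ → ∀ T : ℝ, 0 < T → ∀ a : ℝ, 0 < a →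
      ∃ C : ℝ, ∀ (N : ℕ) (S : ℝ), 0 ≤ S → S ≤ a * (N : ℝ) →
        ∫ x, (∫ t in Set.Ioc (0 : ℝ) S,
            Literature.MathematicalPhysics.KineticTheory.OddSectorLocality.currentForecast ω₂ lam β γ T N t x) ^ 2
          ∂(Literature.MathematicalPhysics.KineticTheory.OddSectorLocality.gibbsWeight ω₂ lam β γ T N)
        ≤ C * (N : ℝ) ^ 2 *
          ∫ x, Real.exp (-((Literature.MathematicalPhysics.KineticTheory.HeatConduction.pinnedChain ω₂ lam β γ).hamiltonian N x) / T)
            ∂MeasureTheory.volume := by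
  sorry

/-- **(EC′) `stub_oneCrossingContraction` — one-crossing echo contraction, affine form** (N-uniform;
THE HARDEST STUB; open-problem sized). There are a cone aperture `a > 0`, a contraction factor
`θ ∈ [0, 1)` and a slack `b ≥ 0` (depending on `ω₂, lam, β, γ, T` only) such that for every `N` and
every horizon `S ≥ 0`
  `‖u_{S+aN} - u_{aN}‖_{L²(μ_T)} ≤ θ · ‖u_S‖_{L²(μ_T)} + b · N · √Z`.
Reading: `u_{S+aN} - u_{aN} = P_{aN} u_S` (Chapman–Kolmogorov `pinnedChain_transitionKernel_add`), and
`‖P_{aN}u_S‖² = ⟨Θ P_{aN} Θ P_{aN} u_S, u_S⟩_π` is the LOSCHMIDT-ECHO fidelity of the forecast after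
one crossing (forward `aN`, flip momenta, forward `aN` with fresh boundary noise, flip back); in
replica form `‖u_S‖² - ‖P_{aN}u_S‖² = ½ E|u_S(X_{aN}) - u_S(X'_{aN})|²` (two open replicas from one
Gibbs point, independent bath noises): one crossing time DESYNCHRONISES a fixed fraction of every
forecast. The slack `b·N·√Z` is an ABSOLUTE bound on the non-scrambling slow sector (Kapitza
boundary layer + resistance-fluctuation / exit-law kernel of the sibling cards; triage r1-3 (F4):
expect the quadrant ratio `θ_N²(τ)` to PLATEAU at `ρ² > 0`, not to decay to `0`). The sharp
conjecture (EC) is `b = 0` (§4; numerics: `θ²(N) ≈ 0.10` with `τ/N`-collapse at `N = 8, 16`,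
diffusive point `(1,1,0.1,1)`, `T = 8`, kit j011605). Status: under the route's fixed-`N`
`CorrectorTheory` (`L²`-limit, `u - u_S = P_S u`), (EC′) is implied by E1 (`θ = 0`, `b = 2√C_E1`) — a
PROOF SHAPE (absorption needs no a-priori size of `‖u‖`), not a logical weakening; fails at
`lam = β = 0` (`θ_N → 1`, Disproof §2b); not the FalseOfLocality shape (one semigroup step at the
crossing scale, no `∫‖P_t·‖dt`); compatible with the closing spectral gap (a factor `θ` at time `aN`
for ONE orbit is a rate `|log θ|/(aN) → 0`). -/
theorem stub_oneCrossingContraction :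
    ∀ ω₂ lam β γ : ℝ, 0 < ω₂ → 0 < lam → 0 < β → 0 < γ → ∀ T : ℝ, 0 < T →
      ∃ a θ b : ℝ, 0 < a ∧ 0 ≤ θ ∧ θ < 1 ∧ 0 ≤ b ∧ ∀ (N : ℕ) (S : ℝ), 0 ≤ S →
        Real.sqrt (∫ x,
            ((∫ t in Set.Ioc (0 : ℝ) (S + a * (N : ℝ)),
                Literature.MathematicalPhysics.KineticTheory.OddSectorLocality.currentForecast ω₂ lam β γ T N t x)
              - ∫ t in Set.Ioc (0 : ℝ) (a * (N : ℝ)),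
                Literature.MathematicalPhysics.KineticTheory.OddSectorLocality.currentForecast ω₂ lam β γ T N t x) ^ 2
            ∂(Literature.MathematicalPhysics.KineticTheory.OddSectorLocality.gibbsWeight ω₂ lam β γ T N))
          ≤ θ * Real.sqrt (∫ x, (∫ t in Set.Ioc (0 : ℝ) S,
                Literature.MathematicalPhysics.KineticTheory.OddSectorLocality.currentForecast ω₂ lam β γ T N t x) ^ 2
              ∂(Literature.MathematicalPhysics.KineticTheory.OddSectorLocality.gibbsWeight ω₂ lam β γ T N))
            + b * (N : ℝ) * Real.sqrt (∫ x,
                Real.exp (-((Literature.MathematicalPhysics.KineticTheory.HeatConduction.pinnedChain ω₂ lam β γ).hamiltonian N x) / T)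
                  ∂MeasureTheory.volume) := by
  sorry

/-- **(M) `stub_horizonCorrectorMemLp`** — CLOSED: LANDED p91238 (`Theorems/OddSectorIrreversibilityConeScaleCorrectorStubHorizonCorrectorMemLp.lean`). Fixed-`N` regularity of the finite-horizon correctors
(size S–M; no N-uniform content). For every `N` and `S ≥ 0`, `u_S ∈ L²(μ_T)`: joint measurability of
`(t, x) ↦ ∫ J_tot d(P.transitionKernel N T T t x)` for the CONSTRUCTED kernels (the solution map is
continuous in `t`, measurable in `(x, ω)`: `pinnedChain_measurable_solMap`), and the no-dynamics bound
`‖u_S‖_{L²(μ_T)} ≤ S · ‖J_tot‖_{L²(μ_T)} < ∞` (Gibbs weight invariant under the equilibrium kernels ⇒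
`P_t` contracts `L²(μ_T)` by Jensen; `J_tot` has Gaussian-moment bounds). It makes the Bochner
integrals / square roots in (B), (EC′) honest and is what Minkowski and Fatou consume in the glue. -/
theorem stub_horizonCorrectorMemLp :
    ∀ ω₂ lam β γ : ℝ, 0 < ω₂ → 0 < lam → 0 < β → 0 < γ → ∀ T : ℝ, 0 < T → ∀ (N : ℕ) (S : ℝ), 0 ≤ S →
      MeasureTheory.MemLp
        (fun x : Literature.MathematicalPhysics.KineticTheory.HeatConduction.PhaseSpace N =>
          ∫ t in Set.Ioc (0 : ℝ) S, Literature.MathematicalPhysics.KineticTheory.OddSectorLocality.currentForecast ω₂ lam β γ T N t x)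
        2 (Literature.MathematicalPhysics.KineticTheory.OddSectorLocality.gibbsWeight ω₂ lam β γ T N) :=
  Summit.AtomisticToContinuum.FouriersLaw.Theorems.OddSectorIrreversibility.stub_horizonCorrectorMemLp

/-! ## §2 Glue lemmas (proved) -/

section RealAnalysis

/-- **Crossing induction** (pure real analysis). If `r ≤ A` on `[0, L]` and one step of length `L`
contracts affinely, `r(S + L) ≤ A + θ·r(S) + B` (`0 ≤ θ < 1`), then `r ≤ (A + B)/(1 - θ)` on `[0, ∞)`:
induction on `⌊S/L⌋` (`L > 0`), directly if `L = 0`. -/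
theorem crossing_induction {r : ℝ → ℝ} {L A B θ : ℝ} (hL : 0 ≤ L) (hθ0 : 0 ≤ θ) (hθ1 : θ < 1)
    (hA : 0 ≤ A) (hB : 0 ≤ B)
    (hbase : ∀ S, 0 ≤ S → S ≤ L → r S ≤ A)
    (hstep : ∀ S, 0 ≤ S → r (S + L) ≤ A + θ * r S + B) :
    ∀ S, 0 ≤ S → r S ≤ (A + B) / (1 - θ) := by
  have h1θ : 0 < 1 - θ := by linarith
  set M := (A + B) / (1 - θ) with hM
  have hAM : A ≤ M := by
    rw [hM, le_div_iff₀ h1θ]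
    nlinarith
  have hfix : A + θ * M + B = M := by
    rw [hM]
    field_simp
    ring
  rcases hL.eq_or_lt with hL0 | hLpos
  · intro S hS
    have h := hstep S hS
    rw [← hL0, add_zero] at h
    rw [hM, le_div_iff₀ h1θ]
    nlinarith
  · have main : ∀ k : ℕ, ∀ S, 0 ≤ S → S ≤ ((k : ℝ) + 1) * L → r S ≤ M := by
      intro k
      induction k with
      | zero =>
        intro S hS hSL
        exact (hbase S hS (by simpa using hSL)).trans hAM
      | succ k ih =>
        intro S hS hSL
        by_cases hSL' : S ≤ L
        · exact (hbase S hS hSL').trans hAM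
        · have hLS : L < S := not_le.mp hSL'
          have hS' : 0 ≤ S - L := by linarith
          have hS'L : S - L ≤ ((k : ℝ) + 1) * L := by
            push_cast at hSL
            linarith
          have h := hstep (S - L) hS'
          rw [sub_add_cancel] at h
          have hih := ih (S - L) hS' hS'L
          calc r S ≤ A + θ * r (S - L) + B := h
            _ ≤ A + θ * M + B := by gcongr
            _ = M := hfix
    intro S hS
    refine main ⌊S / L⌋₊ S hS ?_
    have h := Nat.lt_floor_add_one (S / L)
    rw [div_lt_iff₀ hLpos] at h
    exact h.le

end RealAnalysis

section LTwo

variable {X : Type*} [MeasurableSpace X] {μ : Measure X}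

/-- `‖f‖_{L²(μ)} = ofReal √(∫ f² dμ)` for real `f ∈ L²`. -/
theorem eLpNorm_two_eq_sqrt {f : X → ℝ} (hf : MemLp f 2 μ) :
    eLpNorm f 2 μ = ENNReal.ofReal (Real.sqrt (∫ x, f x ^ 2 ∂μ)) := by
  rw [hf.eLpNorm_eq_integral_rpow_norm two_ne_zero ENNReal.ofNat_ne_top, Real.sqrt_eq_rpow]
  simp only [ENNReal.toReal_ofNat, Real.rpow_two, Real.norm_eq_abs, sq_abs, one_div]

/-- Minkowski in `√∫`-form: `√∫ f² ≤ √∫ g² + √∫ (f - g)²` for `f, g ∈ L²(μ)`. -/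
theorem sqrt_integral_sq_le_of_sub {f g : X → ℝ} (hf : MemLp f 2 μ) (hg : MemLp g 2 μ) :
    Real.sqrt (∫ x, f x ^ 2 ∂μ)
      ≤ Real.sqrt (∫ x, g x ^ 2 ∂μ) + Real.sqrt (∫ x, (f x - g x) ^ 2 ∂μ) := by
  have hfg : MemLp (f - g) 2 μ := hf.sub hg
  have h := eLpNorm_add_le hg.aestronglyMeasurable hfg.aestronglyMeasurable
    (by norm_num : (1 : ℝ≥0∞) ≤ 2)
  have e : g + (f - g) = f := add_sub_cancel g f
  rw [e, eLpNorm_two_eq_sqrt hf, eLpNorm_two_eq_sqrt hg, eLpNorm_two_eq_sqrt hfg,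
    ← ENNReal.ofReal_add (Real.sqrt_nonneg _) (Real.sqrt_nonneg _)] at h
  exact (ENNReal.ofReal_le_ofReal_iff (by positivity)).1 h

/-- **Fatou step.** An a.e. limit (along `S → ∞` in `ℝ`) of functions `f S ∈ L²(μ)` with
`√∫ (f S)² ≤ M` for `S ≥ 0` is in `L²(μ)` with `∫ g² ≤ M²`
(`MeasureTheory.Lp.eLpNorm_le_of_ae_tendsto` through the sequence `S = n`). -/
theorem memLp_and_integral_sq_le_of_tendsto {f : ℝ → X → ℝ} {g : X → ℝ} {M : ℝ} (hM : 0 ≤ M)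
    (hf : ∀ S, 0 ≤ S → MemLp (f S) 2 μ)
    (hbound : ∀ S, 0 ≤ S → Real.sqrt (∫ x, f S x ^ 2 ∂μ) ≤ M)
    (hlim : ∀ᵐ x ∂μ, Tendsto (fun S => f S x) atTop (𝓝 (g x))) :
    MemLp g 2 μ ∧ ∫ x, g x ^ 2 ∂μ ≤ M ^ 2 := by
  have hf' : ∀ n : ℕ, AEStronglyMeasurable (f n) μ := fun n =>
    (hf n (Nat.cast_nonneg n)).aestronglyMeasurable
  have hlim' : ∀ᵐ x ∂μ, Tendsto (fun n : ℕ => f n x) atTop (𝓝 (g x)) := by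
    filter_upwards [hlim] with x hx using hx.comp tendsto_natCast_atTop_atTop
  have hbound' : ∀ᶠ n : ℕ in atTop, eLpNorm (f n) 2 μ ≤ ENNReal.ofReal M := by
    refine Eventually.of_forall fun n => ?_
    rw [eLpNorm_two_eq_sqrt (hf n (Nat.cast_nonneg n))]
    exact ENNReal.ofReal_le_ofReal (hbound n (Nat.cast_nonneg n))
  have hg_meas : AEStronglyMeasurable g μ := aestronglyMeasurable_of_tendsto_ae atTop hf' hlim'
  have hg_norm : eLpNorm g 2 μ ≤ ENNReal.ofReal M :=
    Lp.eLpNorm_le_of_ae_tendsto hbound' hf' hlim'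
  have hg_mem : MemLp g 2 μ := ⟨hg_meas, hg_norm.trans_lt ENNReal.ofReal_lt_top⟩
  refine ⟨hg_mem, ?_⟩
  have h1 : Real.sqrt (∫ x, g x ^ 2 ∂μ) ≤ M := by
    have h := hg_norm
    rw [eLpNorm_two_eq_sqrt hg_mem] at h
    exact (ENNReal.ofReal_le_ofReal_iff hM).1 h
  have h0 : 0 ≤ ∫ x, g x ^ 2 ∂μ := integral_nonneg fun _ => sq_nonneg _
  calc ∫ x, g x ^ 2 ∂μ = Real.sqrt (∫ x, g x ^ 2 ∂μ) ^ 2 := (Real.sq_sqrt h0).symm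
    _ ≤ M ^ 2 := pow_le_pow_left₀ (Real.sqrt_nonneg _) h1 2

end LTwo

section PerChain

variable {ω₂ lam β γ T : ℝ} {N : ℕ}

theorem Zmass_nonneg : 0 ≤ Zmass ω₂ lam β γ T N :=
  integral_nonneg fun _ => (Real.exp_pos _).le

/-- **The per-`N` bound on all finite horizons**: (B) at aperture `a` + (EC′) + (M) give
`‖u_S‖_{L²(μ_T)} ≤ (√(C ⊔ 0) + b)/(1 - θ) · N · √Z` for every `S ≥ 0` (Minkowski + `crossing_induction`). -/
theorem horizonCorrector_norm_le {a θ b C : ℝ} (ha : 0 < a) (hθ0 : 0 ≤ θ) (hθ1 : θ < 1) (hb : 0 ≤ b)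
    (hbud : ∀ S : ℝ, 0 ≤ S → S ≤ a * (N : ℝ) →
      ∫ x, (horizonCorrector ω₂ lam β γ T N S x) ^ 2 ∂(gibbsWeight ω₂ lam β γ T N)
        ≤ C * (N : ℝ) ^ 2 * Zmass ω₂ lam β γ T N)
    (hec : ∀ S : ℝ, 0 ≤ S →
      Real.sqrt (∫ x, (horizonCorrector ω₂ lam β γ T N (S + a * (N : ℝ)) x
                        - horizonCorrector ω₂ lam β γ T N (a * (N : ℝ)) x) ^ 2
                  ∂(gibbsWeight ω₂ lam β γ T N))
        ≤ θ * Real.sqrt (∫ x, (horizonCorrector ω₂ lam β γ T N S x) ^ 2 ∂(gibbsWeight ω₂ lam β γ T N))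
          + b * (N : ℝ) * Real.sqrt (Zmass ω₂ lam β γ T N))
    (hmem : ∀ S : ℝ, 0 ≤ S → MemLp (horizonCorrector ω₂ lam β γ T N S) 2 (gibbsWeight ω₂ lam β γ T N)) :
    ∀ S : ℝ, 0 ≤ S →
      Real.sqrt (∫ x, (horizonCorrector ω₂ lam β γ T N S x) ^ 2 ∂(gibbsWeight ω₂ lam β γ T N))
        ≤ (Real.sqrt (max C 0) + b) / (1 - θ) * (N : ℝ) * Real.sqrt (Zmass ω₂ lam β γ T N) := by
  have hZ0 : 0 ≤ Zmass ω₂ lam β γ T N := Zmass_nonneg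
  have hN0 : (0 : ℝ) ≤ (N : ℝ) := Nat.cast_nonneg N
  have haN : 0 ≤ a * (N : ℝ) := by positivity
  have hA0 : 0 ≤ Real.sqrt (max C 0) * (N : ℝ) * Real.sqrt (Zmass ω₂ lam β γ T N) := by positivity
  have hB0 : 0 ≤ b * (N : ℝ) * Real.sqrt (Zmass ω₂ lam β γ T N) := by positivity
  -- base: (B) on `[0, aN]`
  have hbase : ∀ S : ℝ, 0 ≤ S → S ≤ a * (N : ℝ) →
      Real.sqrt (∫ x, (horizonCorrector ω₂ lam β γ T N S x) ^ 2 ∂(gibbsWeight ω₂ lam β γ T N))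
        ≤ Real.sqrt (max C 0) * (N : ℝ) * Real.sqrt (Zmass ω₂ lam β γ T N) := by
    intro S hS hSL
    have h1 : ∫ x, (horizonCorrector ω₂ lam β γ T N S x) ^ 2 ∂(gibbsWeight ω₂ lam β γ T N)
        ≤ max C 0 * (N : ℝ) ^ 2 * Zmass ω₂ lam β γ T N :=
      (hbud S hS hSL).trans (by gcongr; exact le_max_left _ _)
    calc Real.sqrt (∫ x, (horizonCorrector ω₂ lam β γ T N S x) ^ 2 ∂(gibbsWeight ω₂ lam β γ T N))
        ≤ Real.sqrt (max C 0 * (N : ℝ) ^ 2 * Zmass ω₂ lam β γ T N) := Real.sqrt_le_sqrt h1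
      _ = Real.sqrt (max C 0) * (N : ℝ) * Real.sqrt (Zmass ω₂ lam β γ T N) := by
        rw [Real.sqrt_mul (by positivity : (0 : ℝ) ≤ max C 0 * (N : ℝ) ^ 2),
          Real.sqrt_mul (le_max_right C 0), Real.sqrt_sq hN0]
  -- step: Minkowski + (EC′)
  have hstep : ∀ S : ℝ, 0 ≤ S →
      Real.sqrt (∫ x, (horizonCorrector ω₂ lam β γ T N (S + a * (N : ℝ)) x) ^ 2
          ∂(gibbsWeight ω₂ lam β γ T N))
        ≤ Real.sqrt (max C 0) * (N : ℝ) * Real.sqrt (Zmass ω₂ lam β γ T N)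
          + θ * Real.sqrt (∫ x, (horizonCorrector ω₂ lam β γ T N S x) ^ 2 ∂(gibbsWeight ω₂ lam β γ T N))
          + b * (N : ℝ) * Real.sqrt (Zmass ω₂ lam β γ T N) := by
    intro S hS
    have hmink := sqrt_integral_sq_le_of_sub (hmem (S + a * (N : ℝ)) (by positivity)) (hmem _ haN)
    have hcontr := hec S hS
    have hb' := hbase (a * (N : ℝ)) haN le_rfl
    linarith
  intro S hS
  have key := crossing_induction
    (r := fun S => Real.sqrt (∫ x, (horizonCorrector ω₂ lam β γ T N S x) ^ 2
      ∂(gibbsWeight ω₂ lam β γ T N)))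
    haN hθ0 hθ1 hA0 hB0 hbase hstep S hS
  have h1θ : (1 - θ) ≠ 0 := by linarith
  calc Real.sqrt (∫ x, (horizonCorrector ω₂ lam β γ T N S x) ^ 2 ∂(gibbsWeight ω₂ lam β γ T N))
      ≤ (Real.sqrt (max C 0) * (N : ℝ) * Real.sqrt (Zmass ω₂ lam β γ T N)
          + b * (N : ℝ) * Real.sqrt (Zmass ω₂ lam β γ T N)) / (1 - θ) := key
    _ = (Real.sqrt (max C 0) + b) / (1 - θ) * (N : ℝ) * Real.sqrt (Zmass ω₂ lam β γ T N) := by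
      rw [div_mul_eq_mul_div, div_mul_eq_mul_div, add_mul, add_mul]

/-- **Per-`N` conclusion**: with the a.e.-limit hypothesis of the crux, Fatou turns the all-horizon
bound into `u ∈ L²(μ_T)` and `∫ u² dμ_T ≤ K² · N² · Z`. -/
theorem corrector_bound {a θ b C : ℝ} (ha : 0 < a) (hθ0 : 0 ≤ θ) (hθ1 : θ < 1) (hb : 0 ≤ b)
    (hbud : ∀ S : ℝ, 0 ≤ S → S ≤ a * (N : ℝ) →
      ∫ x, (horizonCorrector ω₂ lam β γ T N S x) ^ 2 ∂(gibbsWeight ω₂ lam β γ T N)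
        ≤ C * (N : ℝ) ^ 2 * Zmass ω₂ lam β γ T N)
    (hec : ∀ S : ℝ, 0 ≤ S →
      Real.sqrt (∫ x, (horizonCorrector ω₂ lam β γ T N (S + a * (N : ℝ)) x
                        - horizonCorrector ω₂ lam β γ T N (a * (N : ℝ)) x) ^ 2
                  ∂(gibbsWeight ω₂ lam β γ T N))
        ≤ θ * Real.sqrt (∫ x, (horizonCorrector ω₂ lam β γ T N S x) ^ 2 ∂(gibbsWeight ω₂ lam β γ T N))
          + b * (N : ℝ) * Real.sqrt (Zmass ω₂ lam β γ T N))
    (hmem : ∀ S : ℝ, 0 ≤ S → MemLp (horizonCorrector ω₂ lam β γ T N S) 2 (gibbsWeight ω₂ lam β γ T N))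
    {u : PhaseSpace N → ℝ}
    (hu : ∀ᵐ x ∂(gibbsWeight ω₂ lam β γ T N),
      Tendsto (fun S : ℝ => horizonCorrector ω₂ lam β γ T N S x) atTop (𝓝 (u x))) :
    MemLp u 2 (gibbsWeight ω₂ lam β γ T N) ∧
      ∫ x, (u x) ^ 2 ∂(gibbsWeight ω₂ lam β γ T N)
        ≤ ((Real.sqrt (max C 0) + b) / (1 - θ)) ^ 2 * (N : ℝ) ^ 2 * Zmass ω₂ lam β γ T N := by
  have hZ0 : 0 ≤ Zmass ω₂ lam β γ T N := Zmass_nonneg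
  have h1θ : 0 < 1 - θ := by linarith
  have hK0 : 0 ≤ (Real.sqrt (max C 0) + b) / (1 - θ) * (N : ℝ) * Real.sqrt (Zmass ω₂ lam β γ T N) := by
    positivity
  have hsup := horizonCorrector_norm_le ha hθ0 hθ1 hb hbud hec hmem
  have h := memLp_and_integral_sq_le_of_tendsto hK0 hmem hsup hu
  refine ⟨h.1, h.2.trans_eq ?_⟩
  rw [mul_pow, mul_pow, Real.sq_sqrt hZ0]

end PerChain

/-! ## §3 The composition: the stubs imply the crux BY NAME -/

/-- **`ConeScaleCorrector_of`** — (B) `stub_finiteHorizonBudget` ∧ (EC′) `stub_oneCrossingContraction` ∧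
(M) `stub_horizonCorrectorMemLp` ⟹ E1, i.e. the route decl `OddSectorIrreversibility.ConeScaleCorrector`
BY NAME. No hypotheses: the three registered stubs are invoked directly and are the ONLY `sorry`s in its
closure; the composition itself (`corrector_bound` + the lines below) is a real proof on the standard
axioms. Constant: `C_E1 = ((√(C_B ⊔ 0) + b)/(1-θ))²` with `(a, θ, b)` from (EC′) and `C_B = C(a, T)`
from (B); the crux's a.e.-limit hypothesis enters through Fatou only. -/
theorem ConeScaleCorrector_of : ConeScaleCorrector := by
  intro ω₂ lam β γ hω hl hβ hγ T hT
  obtain ⟨a, θ, b, ha, hθ0, hθ1, hb, hec⟩ := stub_oneCrossingContraction ω₂ lam β γ hω hl hβ hγ T hT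
  obtain ⟨C, hbud⟩ := stub_finiteHorizonBudget ω₂ lam β γ hω hl hβ hγ T hT a ha
  refine ⟨((Real.sqrt (max C 0) + b) / (1 - θ)) ^ 2, fun N u hu => ?_⟩
  exact corrector_bound ha hθ0 hθ1 hb (hbud N) (hec N)
    (stub_horizonCorrectorMemLp ω₂ lam β γ hω hl hβ hγ T hT N) hu

/-! ## §4 Variants recorded for the lead (documentation only — deliberately NOT declarations, so that
the file carries exactly three obligations)

* **(EC) pure contraction** — the sharp, scale-free conjecture behind (EC′): `b = 0`, i.e.
  `stub_oneCrossingContraction` with the last summand deleted (`θ_N²(a) := sup_S ‖P_{aN}u_S‖²/‖u_S‖² ≤ θ² < 1`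
  uniformly in `N`). Strictly STRONGER than E1 (not implied by it); trivially implies (EC′). Decision
  rule (triage r1-2/3): the plateau of the quadrant ratio `θ_N²(τ)`, `τ ∈ [2N, 3N]`, at the diffusive
  point — plateau `ρ² > 0` (resistance-fluctuation sector, (F4)) ⇒ only (EC′) with `b > 0`; decay to
  `0` ⇒ attack (EC). A lead adopting (EC) deletes the `b`-summand (and `∃ b`, `0 ≤ b`) in the statement of
  `stub_oneCrossingContraction` and re-runs `ledger skeleton check`; `ConeScaleCorrector_of` then needs one edit
  (`b := 0`, `hb := le_rfl` when calling `corrector_bound`).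
* **C1 `ConeTransportBudget`** (promote seat, SketchE1Children.lean on the item): the all-horizon
  diffusive envelope `∫ u_τ² dμ_T ≤ C·N·(1+τ)·Z` (`τ ≥ 0`). It implies (B) with `C(a) = (C ⊔ 0)(1+a)`
  (`N(1+aN) ≤ (1+a)N²` for `N ≥ 1`; `N = 0` reads `0 ≤ 0`) and is stronger than (B) for `τ ≪ N`; a
  prover may prove either — (B) is the weakest form the glue consumes.
* **S = ∞ endpoint.** Under the route's `CorrectorTheory` (L²-limit clause) (EC′) at `S = ∞` reads
  `‖u - u_{aN}‖ ≤ θ‖u‖ + bN√Z`, i.e. the promote seat's `PostCrossingForecast` made RELATIVE; the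
  all-`S` form used here avoids the `L²`-limit input altogether (Fatou only). -/

end Summit.AtomisticToContinuum.FouriersLaw.Cruxes.ConeScaleCorrector.OneCrossingEchoContraction
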